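import Summits.Ventures.QEC.Census.KernelReplayFast
import HarnessLib

/-!
# Packed step numerals for the fast kernel RUP replayer (`Census/KernelReplayFast.lean`)

Cell `qec`, PARTITION row type-11 (K2).  Certificate modules that carry their RUP steps as LIST literals
pay ≈ 0.6 ms of ELABORATION per numeral (measured: 254 KB of `[..]` lists = 35 s), which at certificate
scale exceeds the kernel replay itself.  This file lets a module carry each step as TWO NUMERALS
(hex literals elaborate in milliseconds): the clause packed as base-`65536` digits `ℓ + 1` and the hints
packed as base-`65536` digits `id` (both least-significant first, no zero digit, so `0` terminates), and
unpacks them IN THE KERNEL to the `List (List ℕ × List ℕ)` that `KRupFast.checkAll` consumes — so every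
soundness theorem of `KernelReplayFastSound.lean` / `KernelReplayFastLeaf.lean` applies verbatim to
`unpackSteps f fl psteps`.  Raw recursors, as in the checker.  Measured (farm, BB144 `W = 10` leaf,
21 431 hints): replay over unpacked steps ≈ 0.75 ms/hint all-in vs ≈ 0.33 ms/hint + ≈ 0.75 ms/hint of
list elaboration for the list form; density 5.2 vs 7.4 bytes/hint.  Requires ids `< 65536` and literals
`< 65535` (true for every qec kernel-B leaf: ≤ 6.4 k base clauses + ≤ 35 k steps, ≤ 3.3 k literals).
-/

namespace Summit.Ventures.QEC.Census.KRupFast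

/-- Unpack a clause numeral: base-65536 digits `ℓ+1` (least significant first) ↦ the literal list
(`fl` = digit fuel). -/
noncomputable def unpackLits (fl : ℕ) (p : ℕ) : List ℕ :=
  Nat.rec (motive := fun _ => ℕ → List ℕ) (fun _ => [])
    (fun _ rec p => cond (Nat.beq p 0) [] (Nat.sub (Nat.land p 65535) 1 :: rec (Nat.shiftRight p 16))) fl p

/-- Unpack a hint numeral: base-65536 digits = clause ids (least significant first; `f` = digit fuel). -/
noncomputable def unpackHints (f : ℕ) (p : ℕ) : List ℕ :=
  Nat.rec (motive := fun _ => ℕ → List ℕ) (fun _ => [])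
    (fun _ rec p => cond (Nat.beq p 0) [] (Nat.land p 65535 :: rec (Nat.shiftRight p 16))) f p

/-- Unpack packed steps `(clause numeral, hints numeral)` to `checkAll`'s step list (order kept). -/
noncomputable def unpackSteps (f fl : ℕ) (ps : List (ℕ × ℕ)) : List (List ℕ × List ℕ) :=
  List.rec (motive := fun _ => List (List ℕ × List ℕ)) []
    (fun st _ acc => (unpackLits fl st.1, unpackHints f st.2) :: acc) ps

/-- Control: `unpackLits 4 0x30001 = [0, 2]` (digits `1, 3`). -/
theorem unpackLits_example : unpackLits 4 0x30001 = [0, 2] := by decide +kernel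

/-- Control: `unpackHints 4 0x600050001 = [1, 5, 6]`. -/
theorem unpackHints_example : unpackHints 4 0x600050001 = [1, 5, 6] := by decide +kernel

/-- Control: one packed step. -/
theorem unpackSteps_example : unpackSteps 4 4 [(0x30001, 0x600050001)] = [([0, 2], [1, 5, 6])] := by
  decide +kernel

end Summit.Ventures.QEC.Census.KRupFast
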